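import Summits.Ventures.CertifiedArithmetic.LowPrec.SRKahanEnvelopes
import Summits.Ventures.CertifiedArithmetic.LowPrec.SRFaithful
import Summits.Ventures.CertifiedArithmetic.LowPrec.SRFormatsBridge
import Summits.Ventures.CertifiedArithmetic.LowPrec.SRMonotone
import HarnessLib

/-!
# Stochastic rounding XXXI — compensated summation under SR: every format, kernel certificates

HONEST FRAMING (venture CertifiedArithmetic / cell `pub-lowprec`, seat SR): certified error
envelopes and provably optimal rounding/accumulation schemes for low-precision formats under stated
cost models; every table by two implementations; no hardware or vendor claims.

Format-level corollaries and kernel-decided instances of files XXIX–XXX (`SRKahan.lean`,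
`SRKahanEnvelopes.lean`: Kahan's compensated loop `y = SR(x − c)`, `t = SR(s + y)`,
`d = SR(t − s)`, `c' = SR(d − y)` executed under the saturating stochastic rounding `SR_F` of
[ConnollyHighamMary2021, (2.1), (2.5)], exact expectation operator `kahanExp`, variance functional
`kahanVar` in which the large addition `t` carries weight ZERO).

* `kahanExp_start` — from the state `(0, 0)` the first summand `x₁ ∈ F` enters exactly, so the
  cell's row convention "state `(x₁, 0)`, summands `x₂, x₃, …`" loses nothing.
* `innerVar_eq_of_abs_le` — EVERY format `φ` (value set `F_φ`, saturating clamp included): if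
  `s, y ∈ F_φ` and `|y| ≤ |s|` then for BOTH candidates `t` of `SR(s + y)` the difference `t − s`
  is a format value (faithfulness + Sterbenz, `SRFaithful.dn_sub_mem`), so the d-op is exact and
  the per-step variance reduces to the y-op and the c-op: `innerVar F_φ s y t = v_F(t − s − y)`,
  the c-op acting on (minus) the committed error of the large addition.
* KERNEL CERTIFICATES (`decide +kernel`, each the corresponding row of the two-implementation
  tables `certs/sr/gen8/kahan/`), FP4 `E2M1` and FP6 `E3M2`:
  - `e2m1_kahan_sat_witness` `(4, 4, −6)`: the large addition `4 + 4 = 8 > 6` SATURATES, plain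
    SR returns `E ŝ = 0` for the exact sum `2` (gen1 `triple_sat_bias_witness`), while the
    compensated loop satisfies `NoSatK` and returns `s − c = 2` SURELY;
  - `e2m1_kahan_var_witness` `(−6, 1/2, 1)`: gen1's maximal-variance triple (`Var ŝ = 3/2`) is
    summed EXACTLY by the compensated loop (`kahanVar = 0`, `P[s − c = −9/2] = 1`);
  - `e2m1_kahan_worse_witness` `(−3/2, 4, −3)`: honest counter-witness — both loops unbiased, but
    `Var(s − c) = kahanVar = 5/8 > 1/4 = Var ŝ` and `P[s − c exact] = 0`: compensation is NOT a
    sure variance reduction in a 2-bit-mantissa format;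
  - `e2m1_kahan_quad_witness` `(4, 3/2, −1, −1)`: `Var(s − c) = 1/16` against `Var ŝ = 15/8`
    (ratio `30`, the largest finite ratio over `E2M1` 4-vectors of this menu), `P[exact] = 3/4`;
  - `e3m2_kahan_var_witness` `(16, 7/4, 7/4)`: `Var(s − c) = 63/2048` against `Var ŝ = 63/8`
    (ratio `256 = 4^4`: the summand-scale versus running-sum-scale spacing, squared);
  - `e3m2_kahan_top_witness` `(28, 7/4, −7/4)`: at the TOP of the format the large addition
    saturates (`28 + 7/4 > 28`), plain SR returns `E ŝ = 105/4`, the compensated loop returns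
    `28` surely;
  - `e3m2_kahan_drift_witness` `(24, 7/4, 7/4)`: plain SR drifts into saturation (`NoSat` fails,
    `E ŝ = 1711/64 ≠ 55/2`) while the compensated state never leaves the hull (`NoSatK`,
    `E(s − c) = 55/2`, `Var = 63/2048`).
  Deterministic round-to-nearest counterpart in the cell: `CompensatedSum.lean` (Neumaier's
  variant under `roundNE`, worst-case envelope); here the rounding is stochastic and the results
  are exact laws.
-/

namespace Summit.Ventures.CertifiedArithmetic.LowPrec.SR

open Literature.ComputerArithmetic.ConnollyHighamMary2021
open Literature.ComputerArithmetic.FloatingPoint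
open Literature.ComputerArithmetic.FloatingPoint.MiniFloat
open Finset

section General

variable {K : Type*} [Field K] [LinearOrder K] [IsStrictOrderedRing K]

omit [Field K] [IsStrictOrderedRing K] in
/-- A member of `F` lies in the hull of `F`. -/
theorem inHull_of_mem {F : Finset K} {v : K} (hv : v ∈ F) : InHull F v :=
  ⟨⟨v, hv, le_rfl⟩, ⟨v, hv, le_rfl⟩⟩

omit [IsStrictOrderedRing K] in
/-- **The first summand enters exactly.** From the state `(s, c) = (0, 0)` one compensated step on
a summand `x₁ ∈ F` (with `0 ∈ F`) returns the state `(x₁, 0)` surely: all four operations act on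
members of `F`. Hence `n + 1` summands from `(0, 0)` = `n` summands from `(x₁, 0)`. -/
theorem kahanExp_start (F : Finset K) (h0 : (0 : K) ∈ F) (x : ℕ → K) (hx : x 0 ∈ F) (n : ℕ)
    (g : K → K → K) :
    kahanExp F x (n + 1) g 0 0 = kahanExp F (fun i => x (i + 1)) n g (x 0) 0 := by
  simp only [kahanExp, kahanStep, kahanInner, sub_zero, step_of_mem hx, zero_add, sub_self,
    step_of_mem h0]

end General

/-! ### Every format: the d-op is exact when the running sum dominates -/

variable {φ : Format}

/-- **d-op exactness, every format (saturating clamp included).** For format values `s = a`,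
`y = b` with `|y| ≤ |s|` and either candidate `t ∈ {⌊s + y⌋, ⌈s + y⌉}` of the large addition,
`t − s ∈ F_φ` [`SRFaithful.dn_sub_mem`: faithfulness + Sterbenz]; so `d = SR(t − s) = t − s`
surely, its variance term vanishes, and the inner variance of the step is the single c-op term
`v_F(clamp(t − s − y))` — the c-op applied to minus the committed error `s + y − t`. -/
theorem innerVar_eq_of_abs_le (a b : MiniFloat φ) (hab : |b.toRat| ≤ |a.toRat|) :
    OnBoth (valueSet φ) (a.toRat + b.toRat) fun t =>
      innerVar (valueSet φ) a.toRat b.toRat t =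
        srVar (valueSet φ) (clamp (valueSet φ) (t - a.toRat - b.toRat)) := by
  have key : ∀ t : ℚ, t - a.toRat ∈ valueSet φ →
      innerVar (valueSet φ) a.toRat b.toRat t =
        srVar (valueSet φ) (clamp (valueSet φ) (t - a.toRat - b.toRat)) := by
    intro t ht
    unfold innerVar
    rw [clamp_eq_self (inHull_of_mem ht), srVar_eq_zero_of_mem ht, step_of_mem ht, zero_add]
  obtain ⟨hd, hu⟩ := dn_sub_mem a b hab
  exact ⟨key _ hu, key _ hd⟩

/-- Under the same hypothesis the d-op RETURNS `t − s` surely: the inner continuation is evaluated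
at `d = t − s` only. -/
theorem kahanInner_eq_of_abs_le (a b : MiniFloat φ) (hab : |b.toRat| ≤ |a.toRat|)
    (g : ℚ → ℚ → ℚ) :
    OnBoth (valueSet φ) (a.toRat + b.toRat) fun t =>
      kahanInner (valueSet φ) a.toRat b.toRat t g =
        step (valueSet φ) (t - a.toRat - b.toRat) fun c' => g t c' := by
  have key : ∀ t : ℚ, t - a.toRat ∈ valueSet φ →
      kahanInner (valueSet φ) a.toRat b.toRat t g =
        step (valueSet φ) (t - a.toRat - b.toRat) fun c' => g t c' := by
    intro t ht
    unfold kahanInner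
    rw [step_of_mem ht]
  obtain ⟨hd, hu⟩ := dn_sub_mem a b hab
  exact ⟨key _ hu, key _ hd⟩

/-! ### Kernel certificates, FP4 `E2M1` (value set `FP4.e2m1 = valueSet E2M1`) -/

section E2M1

open FP4 (e2m1 seq3)

/-- `(4, 4, −6)`, exact sum `2`: the large addition saturates (`8 > 6`), plain SR is biased
(`E ŝ = 0`), the compensated loop meets `NoSatK` and returns `s − c = 2` surely. -/
theorem e2m1_kahan_sat_witness :
    ¬ InHull e2m1 ((4 : ℚ) + 4) ∧ accExp e2m1 (seq3 4 (-6) 0) 2 (fun t => t) 4 = 0 ∧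
      NoSatK e2m1 (seq3 4 (-6) 0) 2 4 0 ∧
      kahanExp e2m1 (seq3 4 (-6) 0) 2 (fun s c => if s - c = 2 then 1 else 0) 4 0 = 1 := by
  decide +kernel

/-- `(−6, 1/2, 1)`, exact sum `−9/2`: gen1's maximal-variance triple (`Var ŝ = 3/2`, plain SR
unbiased) is summed exactly by the compensated loop: `kahanVar = 0`, `P[s − c = −9/2] = 1`. -/
theorem e2m1_kahan_var_witness :
    NoSat e2m1 (seq3 (1/2) 1 0) 2 (-6) ∧ accVar e2m1 (seq3 (1/2) 1 0) 2 (-6) = 3 / 2 ∧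
      NoSatK e2m1 (seq3 (1/2) 1 0) 2 (-6) 0 ∧ kahanVar e2m1 (seq3 (1/2) 1 0) 2 (-6) 0 = 0 ∧
      kahanExp e2m1 (seq3 (1/2) 1 0) 2 (fun s c => if s - c = -9/2 then 1 else 0) (-6) 0 = 1 := by
  decide +kernel

/-- HONEST COUNTER-WITNESS `(−3/2, 4, −3)`, exact sum `−1/2`: both loops are unbiased, but the
compensated one has the LARGER variance, `kahanVar = 5/8 > 1/4 = accVar`, and is never exact. -/
theorem e2m1_kahan_worse_witness :
    NoSat e2m1 (seq3 4 (-3) 0) 2 (-3/2) ∧ accVar e2m1 (seq3 4 (-3) 0) 2 (-3/2) = 1 / 4 ∧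
      NoSatK e2m1 (seq3 4 (-3) 0) 2 (-3/2) 0 ∧ kahanVar e2m1 (seq3 4 (-3) 0) 2 (-3/2) 0 = 5 / 8 ∧
      kahanExp e2m1 (seq3 4 (-3) 0) 2 (fun s c => (s - c - (-1/2)) ^ 2) (-3/2) 0 = 5 / 8 ∧
      kahanExp e2m1 (seq3 4 (-3) 0) 2 (fun s c => if s - c = -1/2 then 1 else 0) (-3/2) 0
        = 0 := by
  decide +kernel

set_option maxHeartbeats 1600000 in
/-- `(4, 3/2, −1, −1)`, exact sum `7/2`, three compensated steps (`4096` leaves; kernel decision,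
heartbeat budget raised): `Var(s − c) = kahanVar = 1/16` against `Var ŝ = accVar = 15/8` (ratio
`30`), and `P[s − c = 7/2] = 3/4`. -/
theorem e2m1_kahan_quad_witness :
    NoSat e2m1 (seq3 (3/2) (-1) (-1)) 3 4 ∧ accVar e2m1 (seq3 (3/2) (-1) (-1)) 3 4 = 15 / 8 ∧
      NoSatK e2m1 (seq3 (3/2) (-1) (-1)) 3 4 0 ∧
      kahanVar e2m1 (seq3 (3/2) (-1) (-1)) 3 4 0 = 1 / 16 ∧
      kahanExp e2m1 (seq3 (3/2) (-1) (-1)) 3 (fun s c => if s - c = 7/2 then 1 else 0) 4 0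
        = 3 / 4 := by
  decide +kernel

/-- The saturation witness transported to the format's value set `valueSet E2M1`. -/
theorem valueSet_E2M1_kahan_sat_witness :
    NoSatK (valueSet Format.E2M1) (seq3 4 (-6) 0) 2 4 0 ∧
      kahanExp (valueSet Format.E2M1) (seq3 4 (-6) 0) 2
        (fun s c => if s - c = 2 then 1 else 0) 4 0 = 1 := by
  rw [← e2m1_eq_valueSet]
  exact ⟨e2m1_kahan_sat_witness.2.2.1, e2m1_kahan_sat_witness.2.2.2⟩

end E2M1

/-! ### Kernel certificates, FP6 `E3M2` (value set `Formats.e3m2 = valueSet E3M2`, 63 values) -/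

section E3M2

open FP4 (seq3)
open Formats (e3m2)

/-- `(16, 7/4, 7/4)`, exact sum `39/2`, no saturation anywhere: `Var(s − c) = kahanVar =
63/2048` against `Var ŝ = accVar = 63/8` — ratio `256`. -/
theorem e3m2_kahan_var_witness :
    NoSat e3m2 (seq3 (7/4) (7/4) 0) 2 16 ∧ accVar e3m2 (seq3 (7/4) (7/4) 0) 2 16 = 63 / 8 ∧
      NoSatK e3m2 (seq3 (7/4) (7/4) 0) 2 16 0 ∧
      kahanVar e3m2 (seq3 (7/4) (7/4) 0) 2 16 0 = 63 / 2048 ∧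
      kahanExp e3m2 (seq3 (7/4) (7/4) 0) 2 (fun s c => (s - c - 39/2) ^ 2) 16 0 = 63 / 2048 := by
  decide +kernel

/-- `(28, 7/4, −7/4)` at the TOP of `E3M2`, exact sum `28`: the large addition saturates
(`28 + 7/4 > 28`), plain SR returns `E ŝ = 105/4`; the compensated loop returns `28` surely. -/
theorem e3m2_kahan_top_witness :
    ¬ InHull e3m2 ((28 : ℚ) + 7/4) ∧ accExp e3m2 (seq3 (7/4) (-7/4) 0) 2 (fun t => t) 28 = 105 / 4 ∧
      NoSatK e3m2 (seq3 (7/4) (-7/4) 0) 2 28 0 ∧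
      kahanExp e3m2 (seq3 (7/4) (-7/4) 0) 2 (fun s c => if s - c = 28 then 1 else 0) 28 0 = 1 := by
  decide +kernel

/-- `(24, 7/4, 7/4)`, exact sum `55/2`: plain SR drifts into saturation (`NoSat` fails, `E ŝ =
1711/64`), the compensated state stays in the hull (`NoSatK`) with `E(s − c) = 55/2` and
`Var(s − c) = 63/2048`. -/
theorem e3m2_kahan_drift_witness :
    ¬ NoSat e3m2 (seq3 (7/4) (7/4) 0) 2 24 ∧ accExp e3m2 (seq3 (7/4) (7/4) 0) 2 (fun t => t) 24
        = 1711 / 64 ∧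
      NoSatK e3m2 (seq3 (7/4) (7/4) 0) 2 24 0 ∧
      kahanExp e3m2 (seq3 (7/4) (7/4) 0) 2 (fun s c => s - c) 24 0 = 55 / 2 ∧
      kahanVar e3m2 (seq3 (7/4) (7/4) 0) 2 24 0 = 63 / 2048 := by
  decide +kernel

/-- The top-of-format witness transported to `valueSet E3M2`. -/
theorem valueSet_E3M2_kahan_top_witness :
    NoSatK (valueSet Format.E3M2) (seq3 (7/4) (-7/4) 0) 2 28 0 ∧
      kahanExp (valueSet Format.E3M2) (seq3 (7/4) (-7/4) 0) 2
        (fun s c => if s - c = 28 then 1 else 0) 28 0 = 1 := by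
  rw [← e3m2_eq_valueSet]
  exact ⟨e3m2_kahan_top_witness.2.2.1, e3m2_kahan_top_witness.2.2.2⟩

end E3M2

end Summit.Ventures.CertifiedArithmetic.LowPrec.SR
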